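import Literature.NumberTheory.Automorphic.GL2UnramifiedLFactorDivisibility
import Literature.NumberTheory.Automorphic.GL2RSLFactorCharacter
import Literature.NumberTheory.Automorphic.RankinSelbergLocalUnramifiedCounterexample
import HarnessLib

/-!
# The unramified computation `L(s, π × 1) = ∏_{a ∈ α} (1 - a q^{-s})⁻¹` for `GL₂ × GL₁`

Topic `Literature/NumberTheory/Automorphic`; proof file (theorems only: no definition, no named
fact, no instance).  Assembly of three landed inputs into the unramified computation of the
Jacquet–Piatetski-Shapiro–Shalika `L`-factor of `(π, 1)` on `GL₂(F) × GL₁(F)` — the instance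
`(n, m) = (2, 1)`, `π' = 1`, of the named fact `hasRSLFactor_of_isSatakeParameter_haar` of
`RankinSelbergLocal` (Jacquet–Shalika 1981, §2; JPSS 1983, §2; Cogdell 2004, Thm. 3.3), which for
`GL₂` is Jacquet–Langlands 1970, Prop. 3.5 (`L(s, π(μ₁, μ₂)) = L(s, μ₁) L(s, μ₂)` for unramified
`μᵢ`, `αᵢ = μᵢ(ϖ)`), read through the unramified dictionary (Satake parameters as Hecke
eigenvalues, `IsSatakeParameter`):

* existence of SOME `L`-polynomial `P₀` of `(π, 1)` with `deg P₀ ≤ dim V_N`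
  (`exists_hasRSLFactor_trivial_natDegree_le`, `GL2RSLFactorCharacter`, from
  `existsUnique_hasRSLFactor_fin_two_one` of `GL2RSLFactorExistence` and the pole bound);
* `dim V_N ≤ 2` for irreducible smooth `π` (`finiteDimensional_coinvariants_smoothIrrep_fin_two`,
  `GL2LFactorTwistVanishing`);
* `∏_{a ∈ α} (1 - a X) ∣ P₀`, with equality when `deg P₀ ≤ 2`
  (`prod_one_sub_C_mul_X_eq_of_hasRSLFactor_of_natDegree_le_two`, `GL2UnramifiedLFactorDivisibility`:
  Shintani's formula for the spherical Whittaker function and `W°(1) ≠ 0`).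

Results: `hasRSLFactor_prod_of_isSatakeParameter` (general `V`, finite-dimensional Jacquet module
of dimension `≤ 2` as hypotheses), `hasRSLFactor_satakePairPolynomial_smoothIrrep` (irreducible
smooth generic `π` on `V : Type`), `isSatakeParameter_trivial_gl_one_iff` (the Satake parameter of
the trivial representation of `GL₁(F)` is `{1}`), and the literal instance
`hasRSLFactor_of_isSatakeParameter_haar_two_one_trivial` of the named fact.

## References

* H. Jacquet, R. P. Langlands, *Automorphic Forms on GL(2)*, LNM 114 (1970), Prop. 3.5, Thm. 2.18.
  [JacquetLanglands1970]
* H. Jacquet, J. A. Shalika, *On Euler products and the classification of automorphic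
  representations I*, Amer. J. Math. 103 (1981), §2. [JacquetShalika1981]
* H. Jacquet, I. I. Piatetski-Shapiro, J. A. Shalika, *Rankin–Selberg convolutions*, Amer. J. Math.
  105 (1983), Thm. 2.7. [JacquetPiatetskiShapiroShalika1983]
* J. W. Cogdell, *Analytic theory of `L`-functions for `GL_n`* (2004), Thm. 3.3.
  [CogdellAnalyticTheory2004]
-/

noncomputable section

open scoped MatrixGroups NNReal
open MeasureTheory ValuativeRel Polynomial
  Literature.NumberTheory.GaloisRepresentations.IsNonarchimedeanLocalField

namespace Literature.NumberTheory.Automorphic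

/-! ### `satakePairPolynomial α {1} = ∏_{a ∈ α} (1 - a X)` and the Satake parameter of `1_{GL₁}` -/

section Algebra

/-- `P_{α, {1}} = ∏_{a ∈ α} (1 - a X)`: pairing with the Satake parameter `{1}` of the trivial
representation of `GL₁`. [folklore] -/
theorem satakePairPolynomial_singleton_one (α : Multiset ℂ) :
    satakePairPolynomial α {1} = (α.map fun a => (1 : ℂ[X]) - C a * X).prod := by
  rw [satakePairPolynomial, show ({1} : Multiset ℂ) = 1 ::ₘ 0 from rfl, Multiset.product_cons,
    Multiset.product_zero, add_zero, Multiset.map_map]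
  congr 1
  refine Multiset.map_congr rfl fun a _ => ?_
  simp

variable {F : Type*} [Field F] [ValuativeRel F] [TopologicalSpace F] [IsNonarchimedeanLocalField F]

/-- **The Satake parameter of the trivial representation of `GL₁(F)` is `{1}`**: if `β` is a
Satake parameter of `1_{GL₁(F)}` then `β = {1}` (`card β = 1` and `T₁ = ρ(ϖ) = 1` on the fixed
line, so `e₁(β) = 1`); conversely `isSatakeParameter_trivial_gl_one`. [folklore] -/
theorem isSatakeParameter_trivial_gl_one_iff (ϖ : Fˣ) (β : Multiset ℂ) :
    IsSatakeParameter (Representation.trivial ℂ (GL (Fin 1) F) ℂ) ϖ β ↔ β = {1} := by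
  refine ⟨fun ⟨hcard, v, hv, hv0, hT⟩ => ?_, fun h => by rw [h]; exact isSatakeParameter_trivial_gl_one ϖ⟩
  obtain ⟨b, rfl⟩ := Multiset.card_eq_one.1 hcard
  have h1 := hT 1 le_rfl
  rw [heckeT_self_apply _ ϖ hv, Representation.trivial_apply] at h1
  -- `h1 : v = x • v` with `x = q^0 e₁({b}) = b`, and `v ≠ 0`
  set x : ℂ := (((Real.sqrt (residueFieldCard F) ^ (1 * (1 - 1)) : ℝ) : ℂ) *
    ({b} : Multiset ℂ).esymm 1) with hx
  have hx1 : x = 1 := by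
    have h2 : (x - 1) * v = 0 := by
      rw [sub_mul, one_mul, ← smul_eq_mul, ← h1, sub_self]
    rcases mul_eq_zero.1 h2 with h | h
    · exact sub_eq_zero.1 h
    · exact absurd h hv0
  have hb : b = 1 := by
    simpa [hx, Multiset.esymm, Multiset.powersetCard_one] using hx1
  rw [hb]

end Algebra

/-! ### The unramified computation -/

section Unramified

variable {F : Type*} [Field F] [ValuativeRel F] [TopologicalSpace F] [IsNonarchimedeanLocalField F]
  [MeasurableSpace F] [BorelSpace F]
  [MeasurableSpace (GL (Fin 1) F ⧸ upperUnitriangular (Fin 1) F)]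
  [BorelSpace (GL (Fin 1) F ⧸ upperUnitriangular (Fin 1) F)]

/-- **The unramified computation for `GL₂ × GL₁`, general form** (Jacquet–Langlands 1970,
Prop. 3.5; Jacquet–Shalika 1981, §2; JPSS 1983, Thm. 2.7 with §2; Cogdell 2004, Thm. 3.3).  Let
`π` be an irreducible smooth `ψ`-generic representation of `GL₂(F)` (`ψ` continuous non-trivial)
whose Jacquet module `V_N` is finite-dimensional of dimension `≤ 2`, and `α` a Satake parameter of
`π` w.r.t. a uniformising `ϖ`.  Then for every `GL₁(F)`-invariant Radon full-support `ν` on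
`GL₁(F) ⧸ U₁`, `HasRSLFactor (1<2) π 1 ψ ν (∏_{a ∈ α} (1 - a X))`, i.e.
`L(s, π × 1) = ∏_{a ∈ α} (1 - a q^{-s})⁻¹`: the `L`-polynomial `P₀` exists with `deg P₀ ≤ dim V_N ≤ 2`
and the unramified polynomial divides it with equality in degree `≤ 2`.
[cite: JacquetLanglands1970, Prop. 3.5] [cite: JacquetShalika1981, §2] -/
theorem hasRSLFactor_prod_of_isSatakeParameter {V : Type*} [AddCommGroup V] [Module ℂ V]
    (π : Representation ℂ (GL (Fin 2) F) V) [π.IsIrreducible] (hπ : π.IsSmooth)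
    {ψ : AddChar F Circle} (hψ : ψ.IsContinuousNontrivial) (hgen : IsGeneric π ψ)
    {ϖ : Fˣ} (hϖ : IsUniformizingElement (ϖ : F)) {α : Multiset ℂ} (hα : IsSatakeParameter π ϖ α)
    [FiniteDimensional ℂ (Representation.restrictUnipotentGL F (id : Fin 2 → Fin 2) π).Coinvariants]
    (hVN : Module.finrank ℂ
      (Representation.restrictUnipotentGL F (id : Fin 2 → Fin 2) π).Coinvariants ≤ 2)
    (ν : Measure (GL (Fin 1) F ⧸ upperUnitriangular (Fin 1) F))
    [SMulInvariantMeasure (GL (Fin 1) F) (GL (Fin 1) F ⧸ upperUnitriangular (Fin 1) F) ν]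
    [IsFiniteMeasureOnCompacts ν] [ν.IsOpenPosMeasure] :
    HasRSLFactor Nat.one_lt_two π (Representation.trivial ℂ (GL (Fin 1) F) ℂ) ψ ν
      (α.map fun a => (1 : ℂ[X]) - C a * X).prod := by
  obtain ⟨P, hP, hdeg⟩ := exists_hasRSLFactor_trivial_natDegree_le π hπ hψ hgen ν
  have hPα := prod_one_sub_C_mul_X_eq_of_hasRSLFactor_of_natDegree_le_two π hπ hψ hgen hϖ hα ν hP
    (hdeg.trans hVN)
  rwa [hPα] at hP

/-- **The unramified computation for `GL₂ × GL₁`** (Jacquet–Langlands 1970, Prop. 3.5;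
Jacquet–Shalika 1981, §2; JPSS 1983, §2; Cogdell 2004, Thm. 3.3): for an irreducible smooth
`ψ`-generic representation `π` of `GL₂(F)` on `V : Type` with Satake parameter `α` (w.r.t. a
uniformiser `ϖ`), `ψ` continuous non-trivial and `ν` invariant Radon of full support,
`HasRSLFactor (1<2) π 1 ψ ν (satakePairPolynomial α {1})`, i.e.
`L(s, π × 1) = ∏_{a ∈ α} (1 - a q^{-s})⁻¹ = det(1 - q^{-s} A_π)⁻¹`.
[cite: JacquetLanglands1970, Prop. 3.5] [cite: JacquetShalika1981, §2] [cite: CogdellAnalyticTheory2004, Thm. 3.3] -/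
theorem hasRSLFactor_satakePairPolynomial_smoothIrrep (πv : SmoothIrrep (GL (Fin 2) F))
    {ψ : AddChar F Circle} (hψ : ψ.IsContinuousNontrivial) (hgen : IsGeneric πv.ρ ψ)
    {ϖ : Fˣ} (hϖ : (valuation F).IsUniformizer (ϖ : F)) {α : Multiset ℂ}
    (hα : IsSatakeParameter πv.ρ ϖ α)
    (ν : Measure (GL (Fin 1) F ⧸ upperUnitriangular (Fin 1) F))
    [SMulInvariantMeasure (GL (Fin 1) F) (GL (Fin 1) F ⧸ upperUnitriangular (Fin 1) F) ν]
    [IsFiniteMeasureOnCompacts ν] [ν.IsOpenPosMeasure] :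
    HasRSLFactor Nat.one_lt_two πv.ρ (Representation.trivial ℂ (GL (Fin 1) F) ℂ) ψ ν
      (satakePairPolynomial α {1}) := by
  haveI := πv.isIrreducible
  obtain ⟨hfd, hle⟩ := finiteDimensional_coinvariants_smoothIrrep_fin_two πv
  haveI := hfd
  rw [satakePairPolynomial_singleton_one]
  exact hasRSLFactor_prod_of_isSatakeParameter πv.ρ πv.isSmooth hψ hgen
    (isUniformizingElement_of_isUniformizer hϖ) hα hle ν

/-- **Jacquet–Shalika's unramified computation for `GL₂ × GL₁`, `π'` trivial — the instance
`(n, m) = (2, 1)`, `π' = 1`, of the named fact `hasRSLFactor_of_isSatakeParameter_haar`** of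
`RankinSelbergLocal` (Jacquet–Shalika 1981, §2; JPSS 1983, §2; Cogdell 2004, Thm. 3.3): for `π`
irreducible admissible `ψ`-generic on `V : Type` with Satake parameter `α`, `β` a Satake parameter
of `1_{GL₁(F)}` (necessarily `β = {1}`), `ψ` continuous non-trivial and `ν` invariant Radon of full
support: `HasRSLFactor (1<2) π 1 ψ ν (satakePairPolynomial α β)`.
[cite: JacquetShalika1981, §2] [cite: JacquetLanglands1970, Prop. 3.5] -/
theorem hasRSLFactor_of_isSatakeParameter_haar_two_one_trivial {V : Type} [AddCommGroup V]
    [Module ℂ V] (π : Representation ℂ (GL (Fin 2) F) V) (ψ : AddChar F Circle)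
    (ν : Measure (GL (Fin 1) F ⧸ upperUnitriangular (Fin 1) F))
    [SMulInvariantMeasure (GL (Fin 1) F) (GL (Fin 1) F ⧸ upperUnitriangular (Fin 1) F) ν]
    [IsFiniteMeasureOnCompacts ν] [ν.IsOpenPosMeasure] :
    hasRSLFactor_of_isSatakeParameter_haar Nat.one_lt_two π
      (Representation.trivial ℂ (GL (Fin 1) F) ℂ) ψ ν := by
  intro hirr _ hπ _ hg _ hψ ϖ hϖ α β hα hβ
  obtain rfl := (isSatakeParameter_trivial_gl_one_iff ϖ β).1 hβ
  let πv : SmoothIrrep (GL (Fin 2) F) :=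
    { V := V, ρ := π, isIrreducible := hirr, isSmooth := hπ.isSmooth }
  exact hasRSLFactor_satakePairPolynomial_smoothIrrep πv hψ hg hϖ hα ν

end Unramified

end Literature.NumberTheory.Automorphic

end
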